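import Mathlib

/-!
# Support file for crux `ExactCertificate` (stmt-AtomisticToContinuum-11959), line `closure-makes-nogap-exact`,
# Transfer skeleton II (`Crystallization1D`): stub `stub_goodBlock`

PIGEONHOLE step of the positional crystallization of the Lennard-Jones chain (`d = 1`).  If the gap defects
`η_i` of a ground state satisfy `Σ_{i<n} η_i² ≤ C` and `0 < ε`, then (Chebyshev) at most `C/ε²` indices `i < n`
are bad (`ε < |η_i|`); granted `(C/ε² + 2)·L ≤ n`, the `⌊C/ε²⌋ + 1` disjoint blocks `[mL, (m+1)L)`, `m ≤ K`
(`K` = number of bad indices), all lie inside `range n`, and one of them contains no bad index, since `i ↦ i / L`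
maps the bad set onto at most `K` block labels.  Pure combinatorics / real arithmetic, Mathlib only.
-/

namespace Summit.AtomisticToContinuum.Crystallization.Theorems.ThreeConeCertificateExactCertificate.Transfer1D

open scoped BigOperators

/-- Chebyshev count: if `Σ_{i<n} η_i² ≤ C` and `0 < ε`, the number `K` of indices `i < n` with `ε < |η_i|`
satisfies `K · ε² ≤ C`. [folklore] -/
theorem goodBlock_card_bad_mul_le (n : ℕ) (η : ℕ → ℝ) (C ε : ℝ) (hε : 0 < ε)
    (hC : ∑ i ∈ Finset.range n, η i ^ 2 ≤ C) :
    (((Finset.range n).filter (fun i => ε < |η i|)).card : ℝ) * ε ^ 2 ≤ C := by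
  set B := (Finset.range n).filter (fun i => ε < |η i|) with hB
  have h1 : (B.card : ℝ) * ε ^ 2 = ∑ _i ∈ B, ε ^ 2 := by
    rw [Finset.sum_const, nsmul_eq_mul]
  have h2 : ∑ _i ∈ B, ε ^ 2 ≤ ∑ i ∈ B, η i ^ 2 := by
    refine Finset.sum_le_sum fun i hi => ?_
    have hlt : ε < |η i| := (Finset.mem_filter.mp hi).2
    have h : ε ^ 2 < |η i| ^ 2 := pow_lt_pow_left₀ hlt hε.le two_ne_zero
    rw [sq_abs] at h
    exact h.le
  have h3 : ∑ i ∈ B, η i ^ 2 ≤ ∑ i ∈ Finset.range n, η i ^ 2 :=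
    Finset.sum_le_sum_of_subset_of_nonneg (Finset.filter_subset _ _) fun i _ _ => sq_nonneg (η i)
  linarith

/-- PIGEONHOLE (`stub_goodBlock`): if `Σ_{i<n} η_i² ≤ C`, `0 < ε` and `(C/ε² + 2)·L ≤ n`, there is a block
`[s, s+L) ⊆ [0, n)` of `L` consecutive indices on which every `|η_i| ≤ ε`. [folklore] -/
theorem stub_goodBlock : ∀ (n L : ℕ) (η : ℕ → ℝ) (C ε : ℝ), 0 < ε →
    ∑ i ∈ Finset.range n, η i ^ 2 ≤ C → (C / ε ^ 2 + 2) * (L : ℝ) ≤ n →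
    ∃ s : ℕ, s + L ≤ n ∧ ∀ i : ℕ, s ≤ i → i < s + L → |η i| ≤ ε := by
  intro n L η C ε hε hC hL
  -- the bad set and its cardinality
  set B := (Finset.range n).filter (fun i => ε < |η i|) with hB
  set K := B.card with hK
  have hε2 : 0 < ε ^ 2 := by positivity
  have hKC : (K : ℝ) ≤ C / ε ^ 2 := by
    rw [le_div_iff₀ hε2]
    exact goodBlock_card_bad_mul_le n η C ε hε hC
  -- `(K + 1) * L ≤ n`
  have hKL : (K + 1) * L ≤ n := by
    have h : ((K : ℝ) + 1) * (L : ℝ) ≤ (C / ε ^ 2 + 2) * (L : ℝ) := by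
      apply mul_le_mul_of_nonneg_right _ (Nat.cast_nonneg L)
      linarith
    have h' : (((K + 1) * L : ℕ) : ℝ) ≤ (n : ℝ) := by
      push_cast
      linarith
    exact_mod_cast h'
  -- degenerate block length
  rcases Nat.eq_zero_or_pos L with hL0 | hLpos
  · subst hL0
    exact ⟨0, by simp, fun i _ hi => absurd hi (by simp)⟩
  -- pigeonhole: some block label `m ≤ K` is not `i / L` for a bad `i`
  have hcard : (B.image (fun i => i / L)).card < (Finset.range (K + 1)).card := by
    rw [Finset.card_range]
    exact Nat.lt_succ_of_le Finset.card_image_le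
  obtain ⟨m, hm, hmB⟩ := Finset.exists_mem_notMem_of_card_lt_card hcard
  rw [Finset.mem_range] at hm
  have hmL : (m + 1) * L ≤ n := (Nat.mul_le_mul_right L hm).trans hKL
  refine ⟨m * L, ?_, fun i hi1 hi2 => ?_⟩
  · calc m * L + L = (m + 1) * L := by ring
      _ ≤ n := hmL
  · have hi2' : i < (m + 1) * L := by
      calc i < m * L + L := hi2
        _ = (m + 1) * L := by ring
    have hdiv : i / L = m := Nat.div_eq_of_lt_le hi1 hi2'
    have hin : i < n := hi2'.trans_le hmL
    by_contra hcon
    exact hmB (Finset.mem_image.mpr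
      ⟨i, Finset.mem_filter.mpr ⟨Finset.mem_range.mpr hin, not_le.mp hcon⟩, hdiv⟩)

end Summit.AtomisticToContinuum.Crystallization.Theorems.ThreeConeCertificateExactCertificate.Transfer1D
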